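import Literature.MathematicalPhysics.KineticTheory.Hilbert6Wave0
import Literature.Analysis.FluidPDE.HardSpherePhaseSpace
import HarnessLib

-- provenance: harness21/H21/H21/Prelude/FluidKinetic/BoltzmannEquation.lean @ 60bf3b1 (interim HEAD d8f2665); M5 mechanical rewrite
/-!
# The Boltzmann equation: general kernels, Maxwellians, mild / classical / renormalised solutions
(trunk: FluidKinetic / T-KINETIC, item K4; notions `boltzmann_collision_operator`,
`boltzmann_solutions_mild_renormalized`)

This prelude file extends the velocity-space material of `Literature.Statements.Hilbert6.Wave0`
(hard-sphere collision operator `Hilbert6.collisionOp`, collision law `Hilbert6.collide`, sphere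
measure `Hilbert6.sphereMeasure`, wide-sense Maxwellians `Hilbert6.IsMaxwellian`) to

* the bilinear collision operator `Kinetic.collisionOpWith B f g` for a *general* collision kernel
  `B : E × E → S^{d-1} → ℝ` — the SAME kernel type as Wave0's `Hilbert6.hardSphereKernel` and as
  the argument of G07's `Literature.Analysis.UnboundedOperators.linearizedCollisionOp` (Prelude/UnbddOp/LinearizedBoltzmann) — with
  its gain / loss parts, the identification `collisionOpWith hardSphereKernel = collisionOp`, and
  Grad's cut-off class `Kinetic.IsGradCutoffKernel` (Villani 2002 Ch. 1 §2.4, Ch. 2 §1;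
  Cercignani–Illner–Pulvirenti 1994 §3.2–3.3);
* the explicit global Maxwellian density `Kinetic.globalMaxwellian v = (2π)^{-d/2} e^{-|v|²/2}`
  and local Maxwellians `M_{ρ,u,θ}`, with THE single bridge
  `Kinetic.stdGaussian_eq_withDensity_globalMaxwellian : stdGaussian E = M dv` to the accepted
  G07 convention `M dv := ProbabilityTheory.stdGaussian E` (`Literature.Analysis.UnboundedOperators.maxwellianInner`). Downstream
  (HydrodynamicLimit) all Maxwellian-weighted moments are integrals against `stdGaussian E`;
  `globalMaxwellian` is used only where an explicit density is needed (fluctuations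
  `f = M (1 + δ g)`, local Maxwellians, Lanford data);
* mild solutions in the sense of Gallagher–Saint-Raymond–Texier 2013 §2.1 (Duhamel form along
  free transport, *pointwise* in `(x, v)`: the continuous Lanford class,
  `Kinetic.IsMildBoltzmannSolutionOn`), their a.e.-`(x, v)` variant
  (`Kinetic.IsAEMildBoltzmannSolutionOn`, the DiPerna–Lions / Kaniel–Shinbrot mild notion),
  classical `C¹` solutions (`Kinetic.IsClassicalBoltzmannSolutionOn`), the Gaussian-weighted sup
  norms of Lanford's theorem (`Kinetic.eGaussSupNorm`, `Kinetic.MemLanford`,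
  `Kinetic.ContinuousInLanfordOn`; GST 2013 Thm 5–6) and the total mass;
* DiPerna–Lions renormalised solutions (Ann. Math. 130 (1989) pp. 322–326, with `β(f) = log (1+f)`)
  `Kinetic.IsRenormalisedSolution`, the Boltzmann entropy `H(g) = ∫∫ g log g`, the entropy
  production `D(h) = ¼ ∫∫∫ B (h'h'_* - h h_*) log (h'h'_*/(h h_*)) ≥ 0`, DiPerna–Lions initial data
  and the entropy inequality.

## Mathlib / H21 reuse

Mathlib has no Boltzmann equation, collision operator or Maxwellian *density* (grep
`Boltzmann|Maxwellian|collision` in Mathlib: only `Mathlib/Analysis/SpecialFunctions/Gaussian`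
integrals and `ProbabilityTheory.stdGaussian`, which we bridge to). Reused: `Measure.toSphere` (via
Wave0's `sphereMeasure`), `ProbabilityTheory.stdGaussian`, `Measure.withDensity`,
`intervalIntegral` / `IntervalIntegrable`, `ContDiffOn`, `derivWithin`, `fderiv`,
`HasCompactSupport`, `tsupport`, `LocallyIntegrableOn`, `Module.finrank`, the `InvolutiveNeg`
instance on `Metric.sphere (0 : E) r`. From H21: everything of Wave0 listed above and
`Kinetic.Geometry` / `Torus.geometry` / `Euclidean.geometry` (K1, HardSpherePhaseSpace).

## Design choices

* Velocity space: Wave0's abstract finite-dimensional real inner product space `E` with Borel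
  Lebesgue measure. For statements involving transport on a `Kinetic.Geometry d X` the velocity
  space is specialised to `EuclideanSpace ℝ d` (the type `Geometry.translate` acts with). For
  classical and renormalised solutions on the whole space, positions live in the *same* vector
  space `E` as velocities and free transport is written directly as `x + t v` (this is
  `Euclidean.geometry` when `E = EuclideanSpace ℝ d`), so that `v · ∇ₓ` is `fderiv ℝ (f t · v) x v`.
* Micro-reversibility of a kernel is stated in the GST whole-sphere convention of Wave0's
  `hardSphereKernel = ((v - v_*)·ω)_+`: the pre/post-collisional and particle-exchange symmetries
  both flip `ω ↦ -ω` (`IsGradCutoffKernel.collide_neg`, `IsGradCutoffKernel.swap_neg`).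
* All integrals are Bochner integrals with junk value `0`; integrability appears as explicit
  hypotheses (or structure fields) where theorems need it. `entropyProduction` contains
  `Real.log` of a quotient which is junk (`log` of a nonpositive number, `x / 0 = 0`) unless
  `h > 0`; theorems assume `h > 0`. `IsRenormalisedSolution` carries explicit
  `AEStronglyMeasurable` clauses (slice-wise for `t ≥ 0` and jointly on `(0,∞) × E × E`, NOT
  globally: `f` is unconstrained for `t < 0`) so that its integral identities are genuine.
  `IsAEMildBoltzmannSolutionOn` deliberately has no measurability clause (every downstream use
  adds continuity, and `IsMildBoltzmannSolutionOn.isAEMildBoltzmannSolutionOn` stays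
  hypothesis-free).
* `IsMildBoltzmannSolutionOn` is pointwise in `(x, v)` (right for Lanford's continuous class,
  GST 2013 §2.1 & Thm 5–6); the a.e. version is `IsAEMildBoltzmannSolutionOn` (DiPerna–Lions 1989
  p. 322; Kaniel–Shinbrot).

## References

* I. Gallagher, L. Saint-Raymond, B. Texier, *From Newton to Boltzmann* (2013), §2.1, Thm 5–6.
* R. DiPerna, P.-L. Lions, *On the Cauchy problem for Boltzmann equations: global existence and
  weak stability*, Ann. Math. 130 (1989) 321–366, pp. 322–326.
* R. DiPerna, P.-L. Lions, *Global solutions of Boltzmann's equation and the entropy inequality*,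
  Arch. Rational Mech. Anal. 114 (1991) 47–55.
* C. Cercignani, R. Illner, M. Pulvirenti, *The Mathematical Theory of Dilute Gases* (1994),
  §3.2–3.3.
* C. Villani, *A review of mathematical topics in collisional kinetic theory* (2002), Ch. 1 §2.4,
  Ch. 2 §1.
-/

open MeasureTheory Metric Real Set Filter Topology
open scoped InnerProductSpace ENNReal

namespace Literature.Analysis.FluidPDE

noncomputable section

/-! ## Collision operators with a general kernel -/

section Kernel

variable {E : Type*} [NormedAddCommGroup E] [InnerProductSpace ℝ E] [FiniteDimensional ℝ E]
  [MeasurableSpace E] [BorelSpace E]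

/-- The bilinear Boltzmann collision operator with collision kernel `B(v, v_*, ω)`:
`Q_B(f, g)(v) = ∫_E ∫_{S^{d-1}} B(v, v_*, ω) [f(v') g(v_*') - f(v) g(v_*)] dω dv_*`, where
`(v', v_*') = Hilbert6.collide ω (v, v_*)` (Villani 2002 Ch. 1 §2.3–2.4; CIP 1994 §3.2). The
kernel type `E × E → S^{d-1} → ℝ` is that of Wave0's `Hilbert6.hardSphereKernel` and of G07's
`Literature.Analysis.UnboundedOperators.linearizedCollisionOp`. Bochner integral, junk value `0`. [cite: Villani2002, Ch. 1 §2.3–2.4] -/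
def collisionOpWith (B : E × E → sphere (0 : E) 1 → ℝ) (f g : E → ℝ) (v : E) : ℝ :=
  ∫ w, ∫ ω, B (v, w) ω *
    (f (Literature.MathematicalPhysics.KineticTheory.collide ω (v, w)).1 * g (Literature.MathematicalPhysics.KineticTheory.collide ω (v, w)).2 - f v * g w)
    ∂Literature.MathematicalPhysics.KineticTheory.sphereMeasure

/-- The gain part `Q_B⁺(f, g)(v) = ∫∫ B f(v') g(v_*') dω dv_*` of the collision operator with
kernel `B` (Villani 2002 Ch. 1 §2.3; CIP 1994 (3.1.11)). [cite: Villani2002, Ch. 1 §2.3] -/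
def gainWith (B : E × E → sphere (0 : E) 1 → ℝ) (f g : E → ℝ) (v : E) : ℝ :=
  ∫ w, ∫ ω, B (v, w) ω * (f (Literature.MathematicalPhysics.KineticTheory.collide ω (v, w)).1 * g (Literature.MathematicalPhysics.KineticTheory.collide ω (v, w)).2)
    ∂Literature.MathematicalPhysics.KineticTheory.sphereMeasure

/-- The loss part `Q_B⁻(f, g)(v) = ∫∫ B f(v) g(v_*) dω dv_*` of the collision operator with
kernel `B` (Villani 2002 Ch. 1 §2.3; CIP 1994 (3.1.11)). [cite: Villani2002, Ch. 1 §2.3] -/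
def lossWith (B : E × E → sphere (0 : E) 1 → ℝ) (f g : E → ℝ) (v : E) : ℝ :=
  ∫ w, ∫ ω, B (v, w) ω * (f v * g w) ∂Literature.MathematicalPhysics.KineticTheory.sphereMeasure

/-- For the hard-sphere kernel `((v - v_*)·ω)_+`, `collisionOpWith` is Wave0's hard-sphere
collision operator `Hilbert6.collisionOp` (GST 2013 (2.1.1)). [cite: GST2013, (2.1.1] -/
@[simp]
theorem collisionOpWith_hardSphereKernel :
    collisionOpWith (Literature.MathematicalPhysics.KineticTheory.hardSphereKernel (E := E)) = Literature.MathematicalPhysics.KineticTheory.collisionOp := by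
  funext f g v
  simp only [collisionOpWith, Literature.MathematicalPhysics.KineticTheory.collisionOp, Literature.MathematicalPhysics.KineticTheory.collisionIntegrand]

/-- For the hard-sphere kernel, `gainWith` is Wave0's `Hilbert6.collisionGain`. [folklore] -/
@[simp]
theorem gainWith_hardSphereKernel :
    gainWith (Literature.MathematicalPhysics.KineticTheory.hardSphereKernel (E := E)) = Literature.MathematicalPhysics.KineticTheory.collisionGain := rfl

/-- For the hard-sphere kernel, `lossWith` is Wave0's `Hilbert6.collisionLoss`. [folklore] -/
@[simp]
theorem lossWith_hardSphereKernel :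
    lossWith (Literature.MathematicalPhysics.KineticTheory.hardSphereKernel (E := E)) = Literature.MathematicalPhysics.KineticTheory.collisionLoss := rfl

/-- The collision operator is linear in the kernel: `Q_{cB} = c Q_B` (Villani 2002 Ch. 1 §2.4;
used for the Boltzmann–Grad prefactor `α Q`). [cite: Villani2002, Ch. 1 §2.4] -/
theorem collisionOpWith_smul (c : ℝ) (B : E × E → sphere (0 : E) 1 → ℝ) (f g : E → ℝ) :
    collisionOpWith (c • B) f g = c • collisionOpWith B f g := by
  funext v
  simp only [collisionOpWith, Pi.smul_apply, smul_eq_mul, mul_assoc, integral_const_mul]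

/-- If `gain` and `loss` integrands are integrable over `E × S^{d-1}` at `v`, then
`Q_B(f, g)(v) = Q_B⁺(f, g)(v) - Q_B⁻(f, g)(v)` (CIP 1994 (3.1.11)). [cite: CIP1994, (3.1.11] -/
def collisionOpWith_eq_gainWith_sub_lossWith : Prop :=
  ∀ (B : E × E → sphere (0 : E) 1 → ℝ) (f g : E → ℝ) (v : E) (hgain : Integrable (fun q : E × sphere (0 : E) 1 => B (v, q.1) q.2 * (f (Literature.MathematicalPhysics.KineticTheory.collide q.2 (v, q.1)).1 * g (Literature.MathematicalPhysics.KineticTheory.collide q.2 (v, q.1)).2)) (volume.prod Literature.MathematicalPhysics.KineticTheory.sphereMeasure)) (hloss : Integrable (fun q : E × sphere (0 : E) 1 => B (v, q.1) q.2 * (f v * g q.1)) (volume.prod Literature.MathematicalPhysics.KineticTheory.sphereMeasure)),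
    collisionOpWith B f g v = gainWith B f g v - lossWith B f g v

/-- *Grad's cut-off kernels* (hard potentials with angular cut-off, in the whole-sphere
convention of Wave0): `B` is measurable, nonnegative, grows at most linearly in the relative
velocity, `|B(v, v_*, ω)| ≤ C (1 + |v - v_*|)`, and is micro-reversible: invariant under the
pre/post-collisional change of variables `(v, v_*, ω) ↦ (v', v_*', -ω)` and under the exchange
`(v, v_*, ω) ↦ (v_*, v, -ω)` (Villani 2002 Ch. 1 §2.4 (Grad's cut-off assumption), Ch. 2 §1;
CIP 1994 §3.2; the hard-sphere kernel is the model case, `isGradCutoffKernel_hardSphereKernel`).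
[cite: Villani2002, Ch. 1 §2.4 (Grad's cut-off assumption] -/
structure IsGradCutoffKernel (B : E × E → sphere (0 : E) 1 → ℝ) : Prop where
  /-- Joint measurability of `(v, v_*, ω) ↦ B(v, v_*, ω)`. -/
  measurable : Measurable (Function.uncurry B)
  /-- `B ≥ 0`. -/
  nonneg : ∀ p ω, 0 ≤ B p ω
  /-- Grad's cut-off / linear growth bound `B ≤ C (1 + |v - v_*|)`. -/
  exists_bound : ∃ C : ℝ, ∀ p ω, B p ω ≤ C * (1 + ‖p.1 - p.2‖)
  /-- Micro-reversibility: `B(v', v_*', -ω) = B(v, v_*, ω)`. -/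
  collide_neg : ∀ p ω, B (Literature.MathematicalPhysics.KineticTheory.collide ω p) (-ω) = B p ω
  /-- Exchange symmetry: `B(v_*, v, -ω) = B(v, v_*, ω)`. -/
  swap_neg : ∀ p ω, B p.swap (-ω) = B p ω

/-- The hard-sphere kernel `((v - v_*)·ω)_+` is a Grad cut-off kernel (Villani 2002 Ch. 1 §2.4;
`((v - v_*)·ω)_+ ≤ |v - v_*|`). [cite: Villani2002, Ch. 1 §2.4] -/
theorem isGradCutoffKernel_hardSphereKernel :
    IsGradCutoffKernel (Literature.MathematicalPhysics.KineticTheory.hardSphereKernel (E := E)) where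
  measurable := by
    refine Continuous.measurable ?_
    unfold Function.uncurry Literature.MathematicalPhysics.KineticTheory.hardSphereKernel
    fun_prop
  nonneg p ω := le_max_right _ _
  exists_bound := ⟨1, fun p ω => by
    rw [Literature.MathematicalPhysics.KineticTheory.hardSphereKernel, one_mul, max_le_iff]
    refine ⟨?_, by positivity⟩
    calc ⟪p.1 - p.2, (ω : E)⟫_ℝ ≤ ‖p.1 - p.2‖ * ‖(ω : E)‖ := real_inner_le_norm _ _
      _ = ‖p.1 - p.2‖ := by rw [norm_eq_of_mem_sphere ω, mul_one]
      _ ≤ 1 + ‖p.1 - p.2‖ := by linarith⟩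
  collide_neg p ω := by
    have h := Literature.MathematicalPhysics.KineticTheory.real_inner_self_sphere ω
    simp only [Literature.MathematicalPhysics.KineticTheory.hardSphereKernel, Literature.MathematicalPhysics.KineticTheory.collide, coe_neg_sphere, inner_neg_right,
      inner_sub_left, inner_add_left, inner_smul_left, h, RCLike.conj_to_real]
    congr 1
    ring
  swap_neg p ω := by
    simp only [Literature.MathematicalPhysics.KineticTheory.hardSphereKernel, Prod.fst_swap, Prod.snd_swap, coe_neg_sphere,
      inner_neg_right, ← inner_neg_left, neg_sub]

variable {X : Type*}

/-- The Boltzmann collision term of a one-particle density `f(s, y, ·)`, frozen in `(s, y)`: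
`(s, y) ↦ Q_B(f(s, y, ·), f(s, y, ·))` (GST 2013 (2.1.1)). [cite: GST2013, (2.1.1] -/
def collisionTerm (B : E × E → sphere (0 : E) 1 → ℝ) (f : ℝ → X → E → ℝ) : ℝ → X → E → ℝ :=
  fun s y => collisionOpWith B (f s y) (f s y)

end Kernel

/-! ## Maxwellians -/

section Maxwellian

variable {E : Type*} [NormedAddCommGroup E] [InnerProductSpace ℝ E]

/-- The global (centred, unit-temperature, unit-mass) Maxwellian density
`M(v) = (2π)^{-d/2} exp (-|v|²/2)`, `d = dim E` (CIP 1994 §3.2; Villani 2002 Ch. 1 §2.4). Its law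
`M dv` is `ProbabilityTheory.stdGaussian E` (`stdGaussian_eq_withDensity_globalMaxwellian`). [cite: CIP1994, §3.2] -/
def globalMaxwellian (v : E) : ℝ :=
  (2 * π) ^ (-(Module.finrank ℝ E : ℝ) / 2) * exp (-‖v‖ ^ 2 / 2)

/-- The local Maxwellian with density `ρ`, bulk velocity `u` and temperature `θ`:
`M_{ρ,u,θ}(v) = ρ (2πθ)^{-d/2} exp (-|v - u|²/(2θ))` (CIP 1994 §3.2 (3.2.15); Villani 2002 Ch. 1
§2.4). Meaningful for `θ > 0` (junk `Real.rpow` / division values otherwise). [cite: CIP1994, §3.2 (3.2.15] -/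
def localMaxwellian (ρ θ : ℝ) (u : E) (v : E) : ℝ :=
  ρ * (2 * π * θ) ^ (-(Module.finrank ℝ E : ℝ) / 2) * exp (-‖v - u‖ ^ 2 / (2 * θ))

/-- `M_{1,0,1} = M`: the global Maxwellian is the local Maxwellian with unit density and
temperature and zero bulk velocity. [folklore] -/
@[simp]
theorem localMaxwellian_one_one_zero :
    localMaxwellian 1 1 (0 : E) = globalMaxwellian := by
  funext v
  simp [localMaxwellian, globalMaxwellian]

/-- The global Maxwellian is everywhere positive. [folklore] -/
theorem globalMaxwellian_pos (v : E) : 0 < globalMaxwellian v :=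
  mul_pos (rpow_pos_of_pos (by positivity) _) (exp_pos _)

/-- The global Maxwellian is a Maxwellian in the wide sense of Wave0
(`Hilbert6.IsMaxwellian`, with `a = log (2π)^{-d/2}`, `b = 0`, `c = -1/2`). [folklore] -/
theorem isMaxwellian_globalMaxwellian : Literature.MathematicalPhysics.KineticTheory.IsMaxwellian (globalMaxwellian : E → ℝ) := by
  refine ⟨log ((2 * π) ^ (-(Module.finrank ℝ E : ℝ) / 2)), -1 / 2, 0, fun v => ?_⟩
  rw [exp_add, exp_add, exp_log (rpow_pos_of_pos (by positivity) _), inner_zero_left, exp_zero,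
    mul_one, globalMaxwellian]
  congr 1
  ring_nf

/-- The global Maxwellian is continuous. [folklore] -/
@[fun_prop]
theorem continuous_globalMaxwellian : Continuous (globalMaxwellian : E → ℝ) := by
  unfold globalMaxwellian
  fun_prop

/-- The global Maxwellian as a complex Gaussian: `M(v) = (2π)^{-d/2} · cexp (-(1/2) |v|² + 0)`,
the shape of Mathlib's `GaussianFourier.integral_cexp_neg_mul_sq_norm_add`. [folklore] -/
theorem ofReal_globalMaxwellian (v : E) :
    (globalMaxwellian v : ℂ) =
      ((2 * π) ^ (-(Module.finrank ℝ E : ℝ) / 2) : ℝ) *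
        Complex.exp (-(1 / 2 : ℂ) * (‖v‖ : ℂ) ^ 2) := by
  rw [globalMaxwellian, Complex.ofReal_mul, Complex.ofReal_exp]
  congr 2
  push_cast
  ring

variable [FiniteDimensional ℝ E] [MeasurableSpace E] [BorelSpace E]

/-- The global Maxwellian has unit mass: `∫ M dv = 1` (Gaussian integral; CIP 1994 §3.2). [cite: CIP1994, §3.2] -/
def integral_globalMaxwellian_eq_one : Prop :=
  ∫ v, globalMaxwellian (E := E) v = 1

/-- Discharge of `integral_globalMaxwellian_eq_one` from Mathlib's Gaussian integral on an inner
product space (`GaussianFourier.integral_rexp_neg_mul_sq_norm`: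
`∫ e^{-b|v|²} dv = (π/b)^{d/2}` with `b = 1/2`). [folklore] -/
theorem integral_globalMaxwellian_eq_one_holds : integral_globalMaxwellian_eq_one (E := E) := by
  unfold integral_globalMaxwellian_eq_one
  have h := GaussianFourier.integral_rexp_neg_mul_sq_norm (V := E) (b := 1 / 2) (by norm_num)
  have h' : ∫ v : E, exp (-‖v‖ ^ 2 / 2) = (2 * π) ^ ((Module.finrank ℝ E : ℝ) / 2) := by
    rw [show (2 * π : ℝ) = π / (1 / 2) by ring, ← h]
    congr 1 with v
    congr 1
    ring
  simp only [globalMaxwellian]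
  rw [integral_const_mul, h', neg_div, rpow_neg (by positivity),
    inv_mul_cancel₀ (rpow_pos_of_pos (by positivity) _).ne']

/-- The global Maxwellian is integrable (the norm of Mathlib's integrable complex Gaussian
`GaussianFourier.integrable_cexp_neg_mul_sq_norm_add` with `b = 1/2`, `c = 0`). [folklore] -/
theorem integrable_globalMaxwellian : Integrable (globalMaxwellian (E := E)) := by
  have h := ((GaussianFourier.integrable_cexp_neg_mul_sq_norm_add (V := E) (b := 1 / 2)
    (by norm_num) 0 0).norm).const_mul ((2 * π) ^ (-(Module.finrank ℝ E : ℝ) / 2))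
  refine h.congr (Eventually.of_forall fun v => ?_)
  have hv := congrArg (fun z : ℂ => ‖z‖) (ofReal_globalMaxwellian v)
  simp only [Complex.norm_real, Real.norm_eq_abs, abs_of_pos (globalMaxwellian_pos v),
    Complex.norm_mul, abs_of_pos (rpow_pos_of_pos (by positivity : (0 : ℝ) < 2 * π) _)] at hv
  simp only [zero_mul, add_zero]
  exact hv.symm

/-- **The bridge to G07's convention.** The standard Gaussian measure of Mathlib
(`ProbabilityTheory.stdGaussian E`, used as `M dv` in `Literature.Analysis.UnboundedOperators.maxwellianInner` and
`Literature.Analysis.UnboundedOperators.linearizedCollisionOp`) is Lebesgue measure with density the global Maxwellian: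
`stdGaussian E = M(v) dv` (CIP 1994 §3.2; density of `N(0, I_d)`). [cite: CIP1994, §3.2] -/
def stdGaussian_eq_withDensity_globalMaxwellian : Prop :=
  ProbabilityTheory.stdGaussian E =
      (volume : Measure E).withDensity (fun v => ENNReal.ofReal (globalMaxwellian v))

/-- The measure `M(v) dv` is finite (`integrable_globalMaxwellian`). [folklore] -/
instance isFiniteMeasure_withDensity_globalMaxwellian :
    IsFiniteMeasure ((volume : Measure E).withDensity
      fun v => ENNReal.ofReal (globalMaxwellian v)) :=
  isFiniteMeasure_withDensity_ofReal integrable_globalMaxwellian.hasFiniteIntegral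

/-- Integration against `M(v) dv` is integration of `M • g` against Lebesgue measure. [folklore] -/
theorem integral_withDensity_globalMaxwellian {F : Type*} [NormedAddCommGroup F] [NormedSpace ℝ F]
    (g : E → F) :
    ∫ v, g v ∂(volume : Measure E).withDensity (fun v => ENNReal.ofReal (globalMaxwellian v)) =
      ∫ v, globalMaxwellian v • g v := by
  rw [integral_withDensity_eq_integral_toReal_smul₀
    (continuous_globalMaxwellian.measurable.ennreal_ofReal.aemeasurable)
    (Eventually.of_forall fun _ => ENNReal.ofReal_lt_top)]
  simp_rw [ENNReal.toReal_ofReal (globalMaxwellian_pos _).le]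

/-- Discharge of `stdGaussian_eq_withDensity_globalMaxwellian`: both sides are finite measures
with the same characteristic function `t ↦ e^{-|t|²/2}` (Mathlib `charFun_stdGaussian`,
`GaussianFourier.integral_cexp_neg_mul_sq_norm_add` with `b = 1/2`, `c = i`, and
`Measure.ext_of_charFun`). [folklore] -/
theorem stdGaussian_eq_withDensity_globalMaxwellian_holds :
    stdGaussian_eq_withDensity_globalMaxwellian (E := E) := by
  unfold stdGaussian_eq_withDensity_globalMaxwellian
  refine Measure.ext_of_charFun (funext fun t => ?_)
  rw [ProbabilityTheory.charFun_stdGaussian, charFun_apply, integral_withDensity_globalMaxwellian]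
  have hI : ∀ v : E, globalMaxwellian v • Complex.exp ((⟪v, t⟫_ℝ : ℂ) * Complex.I) =
      ((2 * π) ^ (-(Module.finrank ℝ E : ℝ) / 2) : ℝ) *
        Complex.exp (-(1 / 2 : ℂ) * (‖v‖ : ℂ) ^ 2 + Complex.I * (⟪t, v⟫_ℝ : ℂ)) := by
    intro v
    rw [Complex.real_smul, ofReal_globalMaxwellian, mul_assoc, ← Complex.exp_add,
      real_inner_comm t v, mul_comm (Complex.I)]
  simp_rw [hI, integral_const_mul]
  rw [GaussianFourier.integral_cexp_neg_mul_sq_norm_add (by norm_num) Complex.I t, ← mul_assoc]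
  have hconst : (((2 * π) ^ (-(Module.finrank ℝ E : ℝ) / 2) : ℝ) : ℂ) *
      ((π : ℂ) / (1 / 2 : ℂ)) ^ ((Module.finrank ℝ E : ℂ) / 2) = 1 := by
    have h2 : ((π : ℂ) / (1 / 2 : ℂ)) ^ ((Module.finrank ℝ E : ℂ) / 2) =
        (((2 * π) ^ ((Module.finrank ℝ E : ℝ) / 2) : ℝ) : ℂ) := by
      rw [Complex.ofReal_cpow (by positivity)]
      push_cast
      congr 1
      ring
    rw [h2, ← Complex.ofReal_mul, neg_div, rpow_neg (by positivity),
      inv_mul_cancel₀ (rpow_pos_of_pos (by positivity) _).ne', Complex.ofReal_one]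
  rw [hconst, one_mul, Complex.I_sq]
  congr 1
  ring

/-- Consequently Maxwellian-weighted integrals are integrals against `stdGaussian E`:
`∫ g dstdGaussian = ∫ g(v) M(v) dv` (`stdGaussian_eq_withDensity_globalMaxwellian_holds` and
`integral_withDensity_eq_integral_toReal_smul₀`). [folklore] -/
theorem integral_stdGaussian_eq_integral_mul_globalMaxwellian (g : E → ℝ) :
    ∫ v, g v ∂ProbabilityTheory.stdGaussian E = ∫ v, globalMaxwellian v * g v := by
  rw [stdGaussian_eq_withDensity_globalMaxwellian_holds, integral_withDensity_globalMaxwellian]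
  rfl

/-- The global Maxwellian is an equilibrium of every collision operator whose integrand vanishes
on collision invariants: `Q_B(M, M) = 0` (CIP 1994 §3.2). [cite: CIP1994, §3.2] -/
theorem collisionOpWith_globalMaxwellian (B : E × E → sphere (0 : E) 1 → ℝ) (v : E) :
    collisionOpWith B globalMaxwellian globalMaxwellian v = 0 := by
  obtain ⟨a, c, b, hf⟩ := isMaxwellian_globalMaxwellian (E := E)
  have h : ∀ (w : E) (ω : sphere (0 : E) 1),
      globalMaxwellian (Literature.MathematicalPhysics.KineticTheory.collide ω (v, w)).1 * globalMaxwellian (Literature.MathematicalPhysics.KineticTheory.collide ω (v, w)).2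
        - globalMaxwellian v * globalMaxwellian w = 0 := by
    intro w ω
    have hi := Literature.MathematicalPhysics.KineticTheory.isCollisionInvariant_quadratic a c b ω (v, w)
    simp only [hf, ← Real.exp_add, hi, sub_self]
  simp [collisionOpWith, h]

end Maxwellian

/-! ## Entropy and entropy production -/

section Entropy

variable {E : Type*} [NormedAddCommGroup E] [InnerProductSpace ℝ E] [FiniteDimensional ℝ E]
  [MeasurableSpace E] [BorelSpace E] {X : Type*}

/-- Boltzmann's `H`-functional (entropy) of a one-particle density on `X × E`:
`H(g) = ∫_X ∫_E g log g dv dx` (DiPerna–Lions 1989 p. 322; CIP 1994 §3.2). Bochner integrals,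
junk value `0`; `0 log 0 = 0` by `Real.log 0 = 0`. [cite: DiPernaLions1989, p. 322] -/
def boltzmannEntropy [MeasureSpace X] (g : X → E → ℝ) : ℝ :=
  ∫ x, ∫ v, g x v * log (g x v)

/-- The entropy production (dissipation) functional of a velocity density `h` for the kernel `B`:
`D_B(h) = ¼ ∫_{E × E × S^{d-1}} B (h' h_*' - h h_*) log (h' h_*' / (h h_*)) dω dv_* dv ≥ 0`
(DiPerna–Lions 1989 p. 323 (10); CIP 1994 §3.2–3.3; Villani 2002 Ch. 1 §2.4). Junk-safe: for
`h` not everywhere positive the `log` of a nonpositive quotient is Mathlib's junk value; theorems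
assume `h > 0`. [cite: DiPernaLions1989, p. 323 (10] -/
def entropyProduction (B : E × E → sphere (0 : E) 1 → ℝ) (h : E → ℝ) : ℝ :=
  4⁻¹ * ∫ q : (E × E) × sphere (0 : E) 1, B q.1 q.2 *
    ((h (Literature.MathematicalPhysics.KineticTheory.collide q.2 q.1).1 * h (Literature.MathematicalPhysics.KineticTheory.collide q.2 q.1).2 - h q.1.1 * h q.1.2) *
      log (h (Literature.MathematicalPhysics.KineticTheory.collide q.2 q.1).1 * h (Literature.MathematicalPhysics.KineticTheory.collide q.2 q.1).2 / (h q.1.1 * h q.1.2)))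
    ∂((volume.prod volume).prod Literature.MathematicalPhysics.KineticTheory.sphereMeasure)

/-- The total (position-integrated) entropy production `∫_X D_B(g(x, ·)) dx`
(DiPerna–Lions 1989 p. 323). [cite: DiPernaLions1989, p. 323] -/
def totalEntropyProduction [MeasureSpace X] (B : E × E → sphere (0 : E) 1 → ℝ) (g : X → E → ℝ) :
    ℝ :=
  ∫ x, entropyProduction B (g x)

/-- The entropy production is nonnegative for a nonnegative kernel and a positive density: the
integrand `B (a - b) log (a / b)` is pointwise `≥ 0` (Boltzmann's H-theorem, CIP 1994 §3.2;
Villani 2002 Ch. 1 §2.4). No integrability is needed (junk value `0` otherwise). [cite: CIP1994, §3.2] -/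
theorem entropyProduction_nonneg {B : E × E → sphere (0 : E) 1 → ℝ} (hB : ∀ p ω, 0 ≤ B p ω)
    {h : E → ℝ} (hpos : ∀ v, 0 < h v) : 0 ≤ entropyProduction B h := by
  refine mul_nonneg (by norm_num) (integral_nonneg fun q => mul_nonneg (hB _ _) ?_)
  set a := h (Literature.MathematicalPhysics.KineticTheory.collide q.2 q.1).1 * h (Literature.MathematicalPhysics.KineticTheory.collide q.2 q.1).2
  set b := h q.1.1 * h q.1.2
  have ha : 0 < a := mul_pos (hpos _) (hpos _)
  have hb : 0 < b := mul_pos (hpos _) (hpos _)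
  rcases le_total b a with hab | hab
  · exact mul_nonneg (sub_nonneg.2 hab) (log_nonneg ((one_le_div hb).2 hab))
  · exact mul_nonneg_of_nonpos_of_nonpos (sub_nonpos.2 hab)
      (log_nonpos (div_pos ha hb).le ((div_le_one hb).2 hab))

/-- The H-theorem identity linking the entropy production to the collision operator (link to
Wave0's `Hilbert6.integral_collisionOp_mul_log_nonpos`): for a Grad cut-off (micro-reversible)
kernel and `h > 0` with `B (h'h_*' - h h_*) log h(v)` integrable on `E × E × S^{d-1}`,
`D_B(h) = -∫ Q_B(h, h)(v) log h(v) dv` (CIP 1994 §3.2 (3.2.4)–(3.2.6); Villani 2002 Ch. 1 §2.4).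
[cite: CIP1994, §3.2 (3.2.4] -/
def entropyProduction_eq_neg_integral_collisionOp_mul_log : Prop :=
  ∀ {B : E × E → sphere (0 : E) 1 → ℝ} (hB : IsGradCutoffKernel B) {h : E → ℝ} (hpos : ∀ v, 0 < h v) (hint : Integrable (fun q : (E × E) × sphere (0 : E) 1 => B q.1 q.2 * (h (Literature.MathematicalPhysics.KineticTheory.collide q.2 q.1).1 * h (Literature.MathematicalPhysics.KineticTheory.collide q.2 q.1).2 - h q.1.1 * h q.1.2) * log (h q.1.1)) ((volume.prod volume).prod Literature.MathematicalPhysics.KineticTheory.sphereMeasure)),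
    entropyProduction B h = -∫ v, collisionOpWith B h h v * log (h v)

/-- *DiPerna–Lions initial data*: `f₀ ≥ 0` with finite mass, second moments in `x` and `v`, and
entropy, `∫∫ f₀ (1 + |x|² + |v|² + |log f₀|) dx dv < ∞` (DiPerna–Lions 1989 p. 322 (5)). Positions
in the vector space `E`. [cite: DiPernaLions1989, p. 322 (5] -/
def HasDiPernaLionsData (f₀ : E → E → ℝ) : Prop :=
  (∀ x v, 0 ≤ f₀ x v) ∧ Integrable (fun z : E × E =>
    f₀ z.1 z.2 * (1 + ‖z.1‖ ^ 2 + ‖z.2‖ ^ 2 + |log (f₀ z.1 z.2)|)) (volume.prod volume)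

/-- The *entropy inequality* along a time-dependent density:
`H(f(t)) + ∫₀ᵗ ∫_X D_B(f(s, x, ·)) dx ds ≤ H(f(0))` for all `t ≥ 0` (entropy *bounds*:
DiPerna–Lions 1989 p. 326, Thm (iii); the inequality with the full dissipation term:
DiPerna–Lions, Arch. Rational Mech. Anal. 114 (1991); Villani 2002 Ch. 2 §1). `ℝ`-valued with
Bochner junk value `0` for a non-integrable dissipation (whose true value is `+∞`); since the
integrand of `entropyProduction` is pointwise `≥ 0` this only weakens the inequality. [cite: DiPernaLions1989, p. 326  Thm (iii] -/
def HasEntropyInequality [MeasureSpace X] (B : E × E → sphere (0 : E) 1 → ℝ) (f : ℝ → X → E → ℝ) :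
    Prop :=
  ∀ t ≥ (0 : ℝ), boltzmannEntropy (f t) + ∫ s in (0 : ℝ)..t, totalEntropyProduction B (f s) ≤
    boltzmannEntropy (f 0)

/-- The total mass `∫_X ∫_E g dv dx` of a one-particle density (GST 2013 §2.1). [cite: GST2013, §2.1] -/
def totalMass [MeasureSpace X] (g : X → E → ℝ) : ℝ :=
  ∫ x, ∫ v, g x v

end Entropy

/-! ## Lanford's weighted sup norms -/

section Lanford

variable {E : Type*} [NormedAddCommGroup E] {X : Type*}

/-- The Gaussian-weighted sup norm of Lanford's theorem,
`‖g‖_β = sup_{x, v} exp (β |v|² / 2) |g(x, v)| ∈ [0, ∞]` (GST 2013, the `X_{0,β}`-norm of the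
function spaces introduced before Thm 5; Thm 5–6). Valued in `ℝ≥0∞`. [cite: GST2013, the  X_{0 β} -norm of the function space] -/
def eGaussSupNorm (β : ℝ) (g : X → E → ℝ) : ℝ≥0∞ :=
  ⨆ x, ⨆ v, ENNReal.ofReal (exp (β / 2 * ‖v‖ ^ 2)) * ‖g x v‖ₑ

/-- The pointwise bound encoded by `eGaussSupNorm`. [folklore] -/
theorem enorm_le_eGaussSupNorm (β : ℝ) (g : X → E → ℝ) (x : X) (v : E) :
    ENNReal.ofReal (exp (β / 2 * ‖v‖ ^ 2)) * ‖g x v‖ₑ ≤ eGaussSupNorm β g :=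
  le_iSup₂ (f := fun x v => ENNReal.ofReal (exp (β / 2 * ‖v‖ ^ 2)) * ‖g x v‖ₑ) x v

/-- Lanford's class: `g` is continuous on `X × E` with finite Gaussian-weighted sup norm
`‖g‖_β < ∞` (GST 2013 Thm 5–6, continuous data of the form `|g(x,v)| ≤ C e^{-β|v|²/2}`). [cite: GST2013, Thm 5–6  continuous data of the form  |g] -/
def MemLanford [TopologicalSpace X] (β : ℝ) (g : X → E → ℝ) : Prop :=
  Continuous (Function.uncurry g) ∧ eGaussSupNorm β g < ∞

/-- Continuity in time with values in Lanford's weighted space on the time set `S`: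
`f(t) ∈ X_β` for `t ∈ S` and `‖f(t) - f(t₀)‖_β → 0` as `t → t₀` within `S`
(GST 2013 Thm 5–6, `C([0,T]; X_{0,β})`). [cite: GST2013, Thm 5–6   C( 0 T] -/
def ContinuousInLanfordOn [TopologicalSpace X] (S : Set ℝ) (β : ℝ) (f : ℝ → X → E → ℝ) : Prop :=
  (∀ t ∈ S, MemLanford β (f t)) ∧
    ∀ t₀ ∈ S, Tendsto (fun t => eGaussSupNorm β (f t - f t₀)) (𝓝[S] t₀) (𝓝 0)

end Lanford

/-! ## Mild solutions along free transport on a geometry -/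

section Mild

variable {d : Type*} [Fintype d] {X : Type*}

/-- Evaluation along the free flow (`f♯` in GST 2013 §2.1): `(f♯)(t, x, v) = f(t, x + t v, v)`,
with `x + t v := G.translate x (t • v)` on the geometry `G` (torus or whole space). [cite: GST2013, §2.1] -/
def alongFlow (G : Geometry d X) (f : ℝ → X → EuclideanSpace ℝ d → ℝ) (t : ℝ) (x : X)
    (v : EuclideanSpace ℝ d) : ℝ :=
  f t (G.translate x (t • v)) v

/-- At time `0` the free flow has not moved: `f♯(0) = f(0)`. [folklore] -/
@[simp]
theorem alongFlow_zero (G : Geometry d X) (f : ℝ → X → EuclideanSpace ℝ d → ℝ)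
    (x : X) (v : EuclideanSpace ℝ d) : alongFlow G f 0 x v = f 0 x v := by
  simp [alongFlow]

/-- *Mild solution of the Boltzmann equation on `[0, T]`* (GST 2013 §2.1, integrated form of
(2.1.1); Lanford's continuous class): `f ≥ 0` and, for EVERY `(x, v)` and `t ∈ [0, T]`, the
collision term is integrable along the characteristic through `(x, v)` and Duhamel's formula
`f♯(t, x, v) = f(0, x, v) + ∫₀ᵗ Q_B(f, f)♯(τ, x, v) dτ` holds. Pointwise in `(x, v)`; the
a.e. notion of DiPerna–Lions / Kaniel–Shinbrot is `IsAEMildBoltzmannSolutionOn`. [cite: GST2013, §2.1  integrated form of (2.1.1] -/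
structure IsMildBoltzmannSolutionOn (T : ℝ) (G : Geometry d X)
    (B : EuclideanSpace ℝ d × EuclideanSpace ℝ d → sphere (0 : EuclideanSpace ℝ d) 1 → ℝ)
    (f : ℝ → X → EuclideanSpace ℝ d → ℝ) : Prop where
  /-- `f(t) ≥ 0` on `[0, T]`. -/
  nonneg : ∀ t ∈ Icc 0 T, ∀ x v, 0 ≤ f t x v
  /-- The collision term is integrable along every characteristic. -/
  intervalIntegrable : ∀ x v, ∀ t ∈ Icc 0 T,
    IntervalIntegrable (fun τ => alongFlow G (collisionTerm B f) τ x v) volume 0 t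
  /-- Duhamel's formula along characteristics. -/
  duhamel : ∀ x v, ∀ t ∈ Icc 0 T, alongFlow G f t x v =
    f 0 x v + ∫ τ in (0 : ℝ)..t, alongFlow G (collisionTerm B f) τ x v

/-- *A.e. mild solution on `[0, T]`* (DiPerna–Lions 1989 p. 322, Kaniel–Shinbrot): the same
Duhamel formulation as `IsMildBoltzmannSolutionOn`, required only for almost every
characteristic `(x, v) ∈ X × ℝ^d`. [cite: DiPernaLions1989, p. 322  Kaniel–Shinbrot] -/
structure IsAEMildBoltzmannSolutionOn [MeasureSpace X] (T : ℝ) (G : Geometry d X)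
    (B : EuclideanSpace ℝ d × EuclideanSpace ℝ d → sphere (0 : EuclideanSpace ℝ d) 1 → ℝ)
    (f : ℝ → X → EuclideanSpace ℝ d → ℝ) : Prop where
  /-- `f(t) ≥ 0` a.e. on `[0, T]`. -/
  nonneg : ∀ t ∈ Icc 0 T, ∀ᵐ z : X × EuclideanSpace ℝ d, 0 ≤ f t z.1 z.2
  /-- Duhamel's formula (with integrable collision term) along almost every characteristic. -/
  duhamel : ∀ᵐ z : X × EuclideanSpace ℝ d, ∀ t ∈ Icc 0 T,
    IntervalIntegrable (fun τ => alongFlow G (collisionTerm B f) τ z.1 z.2) volume 0 t ∧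
    alongFlow G f t z.1 z.2 =
      f 0 z.1 z.2 + ∫ τ in (0 : ℝ)..t, alongFlow G (collisionTerm B f) τ z.1 z.2

variable {T : ℝ} {G : Geometry d X}
  {B : EuclideanSpace ℝ d × EuclideanSpace ℝ d → sphere (0 : EuclideanSpace ℝ d) 1 → ℝ}
  {f : ℝ → X → EuclideanSpace ℝ d → ℝ}

/-- A mild solution on `[0, T]` is a mild solution on every shorter interval `[0, T']`. [folklore] -/
theorem IsMildBoltzmannSolutionOn.mono (hf : IsMildBoltzmannSolutionOn T G B f) {T' : ℝ}
    (hT : T' ≤ T) : IsMildBoltzmannSolutionOn T' G B f where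
  nonneg t ht := hf.nonneg t (Icc_subset_Icc_right hT ht)
  intervalIntegrable x v t ht := hf.intervalIntegrable x v t (Icc_subset_Icc_right hT ht)
  duhamel x v t ht := hf.duhamel x v t (Icc_subset_Icc_right hT ht)

/-- A pointwise mild solution is an a.e. mild solution. [folklore] -/
theorem IsMildBoltzmannSolutionOn.isAEMildBoltzmannSolutionOn [MeasureSpace X]
    (hf : IsMildBoltzmannSolutionOn T G B f) : IsAEMildBoltzmannSolutionOn T G B f where
  nonneg t ht := ae_of_all _ fun z => hf.nonneg t ht z.1 z.2
  duhamel := ae_of_all _ fun z t ht => ⟨hf.intervalIntegrable z.1 z.2 t ht, hf.duhamel z.1 z.2 t ht⟩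

/-- Conservation of mass for mild solutions on the torus (GST 2013 §2.1; CIP 1994 §3.1): for a
Grad cut-off kernel and a mild solution in Lanford's class `X_β`, `β > 0`, uniformly on `[0, T]`
(so that all collision integrals converge absolutely), the total mass `∫_{T^d} ∫ f(t) dv dx` is
constant on `[0, T]`. [cite: GST2013, §2.1] -/
def IsMildBoltzmannSolutionOn.totalMass_eq : Prop :=
  ∀ {f : ℝ → UnitAddTorus d → EuclideanSpace ℝ d → ℝ} (hf : IsMildBoltzmannSolutionOn T (Torus.geometry d) B f) (hB : IsGradCutoffKernel B) {β : ℝ} (hβ : 0 < β) (hL : ∃ C : ℝ≥0∞, C < ∞ ∧ ∀ t ∈ Icc 0 T, eGaussSupNorm β (f t) ≤ C) (hcont : ∀ t ∈ Icc 0 T, Continuous (Function.uncurry (f t))) {t : ℝ} (ht : t ∈ Icc 0 T),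
    totalMass (f t) = totalMass (f 0)

end Mild

/-! ## Classical solutions on the whole space -/

section Classical

variable {E : Type*} [NormedAddCommGroup E] [InnerProductSpace ℝ E] [FiniteDimensional ℝ E]
  [MeasurableSpace E] [BorelSpace E]

/-- *Classical solution of the Boltzmann equation* on the time set `S` with positions in the
vector space `E` (free transport `x + t v`): `f` is `C¹` on `S × E × E`, nonnegative, and
satisfies `∂ₜ f + v · ∇ₓ f = Q_B(f, f)` pointwise, the time derivative being taken within `S`
(GST 2013 (2.1.1); CIP 1994 §3.1). [cite: GST2013, (2.1.1] -/
structure IsClassicalBoltzmannSolutionOn (S : Set ℝ) (B : E × E → sphere (0 : E) 1 → ℝ)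
    (f : ℝ → E → E → ℝ) : Prop where
  /-- `f ∈ C¹(S × E × E)`. -/
  contDiffOn : ContDiffOn ℝ 1 (fun z : ℝ × E × E => f z.1 z.2.1 z.2.2) (S ×ˢ univ)
  /-- `f ≥ 0`. -/
  nonneg : ∀ t ∈ S, ∀ x v, 0 ≤ f t x v
  /-- The Boltzmann equation `∂ₜ f + v · ∇ₓ f = Q_B(f, f)` pointwise on `S × E × E`. -/
  boltzmann : ∀ t ∈ S, ∀ x v,
    derivWithin (fun s => f s x v) S t + fderiv ℝ (fun y => f t y v) x v =
      collisionOpWith B (f t x) (f t x) v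

/-- A classical solution on `[0, T]` in `ℝ^d` is a mild solution for the whole-space geometry
`Euclidean.geometry d` (integrate `d/dτ f♯ = Q(f,f)♯` along characteristics; GST 2013 §2.1). [cite: GST2013, §2.1] -/
def IsClassicalBoltzmannSolutionOn.isMildBoltzmannSolutionOn : Prop :=
  ∀ {d : Type*} [Fintype d] {T : ℝ} {B : EuclideanSpace ℝ d × EuclideanSpace ℝ d → sphere (0 : EuclideanSpace ℝ d) 1 → ℝ} {f : ℝ → EuclideanSpace ℝ d → EuclideanSpace ℝ d → ℝ} (hf : IsClassicalBoltzmannSolutionOn (Icc 0 T) B f),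
    IsMildBoltzmannSolutionOn T (Euclidean.geometry d) B f

end Classical

/-! ## DiPerna–Lions renormalised solutions -/

section Renormalised

variable {E : Type*} [NormedAddCommGroup E] [InnerProductSpace ℝ E] [FiniteDimensional ℝ E]
  [MeasurableSpace E] [BorelSpace E]

/-- Kinetic test functions: `φ ∈ C_c^∞((0, ∞) × E × E)`, i.e. smooth on `ℝ × E × E` with compact
support contained in `{t > 0}` (DiPerna–Lions 1989 p. 326, `𝒟'((0,∞) × ℝ^N × ℝ^N)`). [cite: DiPernaLions1989, p. 326   𝒟'((0 ∞] -/
def IsKineticTest (φ : ℝ → E → E → ℝ) : Prop :=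
  -- `(⊤ : ℕ∞)` = `C^∞`; the `ContDiff` scoped notation `∞` is not opened here because that scope
  -- also reserves the token `ω`, used throughout this file for sphere points.
  ContDiff ℝ (⊤ : ℕ∞) (fun z : ℝ × E × E => φ z.1 z.2.1 z.2.2) ∧
    HasCompactSupport (fun z : ℝ × E × E => φ z.1 z.2.1 z.2.2) ∧
    tsupport (fun z : ℝ × E × E => φ z.1 z.2.1 z.2.2) ⊆ Ioi 0 ×ˢ univ

/-- The renormalised collision term `Q_B(f, f) / (1 + f)` (`β'(f) Q(f,f)` for
`β(f) = log (1 + f)`; DiPerna–Lions 1989 p. 322 (7)–(8)). [cite: DiPernaLions1989, p. 322 (7] -/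
def renormalisedRHS (B : E × E → sphere (0 : E) 1 → ℝ) (f : ℝ → E → E → ℝ) (t : ℝ) (x v : E) :
    ℝ :=
  collisionOpWith B (f t x) (f t x) v / (1 + f t x v)

/-- *Renormalised solution of the Boltzmann equation* in the sense of DiPerna–Lions (Ann. Math.
130 (1989), Definition p. 326 with `β(f) = log (1 + f)`, and (7)–(9) p. 322): `f ≥ 0`,
`f ∈ L^∞_loc([0,∞); L¹((1 + |x|² + |v|²) dx dv))`, `Q^±(f,f)/(1+f) ∈ L¹_loc((0,∞) × E × E)`,
the renormalised equation `(∂ₜ + v·∇ₓ) log (1 + f) = Q(f,f)/(1+f)` holds in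
`𝒟'((0,∞) × E × E)`, and `f ∈ C([0,∞); L¹(E × E))`. Measurability of `f` (jointly on
`(0,∞) × E × E` and of each slice `f(t)`, `t ≥ 0`) is part of the definition, so that the
Bochner integrals in `identity` and `tendsto_integral_abs_sub` are not junk. [folklore] -/
structure IsRenormalisedSolution (B : E × E → sphere (0 : E) 1 → ℝ) (f : ℝ → E → E → ℝ) :
    Prop where
  /-- `f(t) ≥ 0` for `t ≥ 0`. -/
  nonneg : ∀ t ≥ (0 : ℝ), ∀ x v, 0 ≤ f t x v
  /-- Each time slice `f(t)`, `t ≥ 0`, is (a.e. strongly) measurable on `E × E` (so that, with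
  `massEnergy_le`, `f(t) ∈ L¹` and `tendsto_integral_abs_sub` is a genuine `L¹`-continuity). -/
  aestronglyMeasurable_slice : ∀ t ≥ (0 : ℝ),
    AEStronglyMeasurable (fun z : E × E => f t z.1 z.2) (volume.prod volume)
  /-- `f` is jointly (a.e. strongly) measurable on `(0, ∞) × E × E` (so that the distributional
  `identity` is not satisfied vacuously through junk Bochner integrals). Only on `t > 0`: `f` is
  unconstrained for negative times. -/
  aestronglyMeasurable : AEStronglyMeasurable (fun z : ℝ × E × E => f z.1 z.2.1 z.2.2)
    ((volume.prod (volume.prod volume)).restrict (Ioi 0 ×ˢ univ))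
  /-- `sup_{t ∈ [0,T]} ∫∫ f(t) (1 + |x|² + |v|²) dx dv < ∞` for every `T`. -/
  massEnergy_le : ∀ T ≥ (0 : ℝ), ∃ C : ℝ, ∀ t ∈ Icc 0 T,
    ∫⁻ z : E × E, ENNReal.ofReal (f t z.1 z.2 * (1 + ‖z.1‖ ^ 2 + ‖z.2‖ ^ 2)) ∂(volume.prod volume)
      ≤ ENNReal.ofReal C
  /-- `Q⁺(f,f)/(1+f) ∈ L¹_loc((0,∞) × E × E)`. -/
  gain_locallyIntegrableOn : LocallyIntegrableOn (fun z : ℝ × E × E =>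
    gainWith B (f z.1 z.2.1) (f z.1 z.2.1) z.2.2 / (1 + f z.1 z.2.1 z.2.2)) (Ioi 0 ×ˢ univ)
    (volume.prod (volume.prod volume))
  /-- `Q⁻(f,f)/(1+f) ∈ L¹_loc((0,∞) × E × E)`. -/
  loss_locallyIntegrableOn : LocallyIntegrableOn (fun z : ℝ × E × E =>
    lossWith B (f z.1 z.2.1) (f z.1 z.2.1) z.2.2 / (1 + f z.1 z.2.1 z.2.2)) (Ioi 0 ×ˢ univ)
    (volume.prod (volume.prod volume))
  /-- The renormalised equation in the sense of distributions on `(0,∞) × E × E`: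
  `∫∫∫ [log(1+f) (∂ₜφ + v·∇ₓφ) + (Q(f,f)/(1+f)) φ] dv dx dt = 0`. -/
  identity : ∀ φ : ℝ → E → E → ℝ, IsKineticTest φ →
    ∫ t in Ioi (0 : ℝ), ∫ x, ∫ v, (log (1 + f t x v) *
      (deriv (fun s => φ s x v) t + fderiv ℝ (fun y => φ t y v) x v) +
      renormalisedRHS B f t x v * φ t x v) = 0
  /-- `f ∈ C([0,∞); L¹(E × E))`. -/
  tendsto_integral_abs_sub : ∀ t₀ ≥ (0 : ℝ),
    Tendsto (fun t => ∫ z : E × E, |f t z.1 z.2 - f t₀ z.1 z.2| ∂(volume.prod volume))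
      (𝓝[Ici 0] t₀) (𝓝 0)

/-- Smooth, positive, suitably integrable classical solutions are renormalised solutions
(DiPerna–Lions 1989 p. 322: "if `f` is a smooth nonnegative solution ... then (8) holds"; chain
rule for `log (1 + f)` and integration by parts against kinetic test functions). The integrability
hypotheses are exactly the non-differential requirements of the definition. [cite: DiPernaLions1989, p. 322: "if  f  is a smooth nonnegative] -/
def IsClassicalBoltzmannSolutionOn.isRenormalisedSolution : Prop :=
  ∀ {B : E × E → sphere (0 : E) 1 → ℝ} {f : ℝ → E → E → ℝ} (hf : IsClassicalBoltzmannSolutionOn (Ici 0) B f) (hmass : ∀ T ≥ (0 : ℝ), ∃ C : ℝ, ∀ t ∈ Icc 0 T, ∫⁻ z : E × E, ENNReal.ofReal (f t z.1 z.2 * (1 + ‖z.1‖ ^ 2 + ‖z.2‖ ^ 2)) ∂(volume.prod volume) ≤ ENNReal.ofReal C) (hgain : LocallyIntegrableOn (fun z : ℝ × E × E => gainWith B (f z.1 z.2.1) (f z.1 z.2.1) z.2.2) (Ioi 0 ×ˢ univ) (volume.prod (volume.prod volume))) (hloss : LocallyIntegrableOn (fun z : ℝ × E × E => lossWith B (f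 z.1 z.2.1) (f z.1 z.2.1) z.2.2) (Ioi 0 ×ˢ univ) (volume.prod (volume.prod volume))) (hcont : ∀ t₀ ≥ (0 : ℝ), Tendsto (fun t => ∫ z : E × E, |f t z.1 z.2 - f t₀ z.1 z.2| ∂(volume.prod volume)) (𝓝[Ici 0] t₀) (𝓝 0)),
    IsRenormalisedSolution B f

end Renormalised

/-! ## Discharge: classical solutions are mild solutions (GST 2013 §2.1) -/

section ClassicalIsMildProof

variable {d : Type*} [Fintype d]

/-- Discharge of `IsClassicalBoltzmannSolutionOn.isMildBoltzmannSolutionOn` (Gallagher–Saint-Raymond–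
Texier 2013, Part I Ch. 2 §1 "Transport and collisions", eq. (2.1.1) `∂ₜ f + v·∇ₓ f = Q(f, f)`, and
its integrated / mild form along the free flow `S(t)`, Part II Ch. 4–5 "Mild solutions"). Proof
(folklore, method of characteristics): for fixed `(x, v)` the characteristic
`γ(τ) = (τ, x + τ v, v)` maps `[0, T]` into `[0, T] × ℝ^d × ℝ^d`; by the chain rule within
`[0, T]` (a set of unique differentiability when `T > 0`) the function `g = f ∘ γ` has derivative
`Df(γ(τ))·(1, v, 0) = ∂ₜ f + v·∇ₓ f = Q(f, f)♯(τ, x, v)` within `[0, T]`, which is continuous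
on `[0, T]` because `f ∈ C¹([0, T] × ℝ^d × ℝ^d)`; the fundamental theorem of calculus
(`intervalIntegral.integral_eq_sub_of_hasDerivAt_of_le`) then gives Duhamel's formula
`f♯(t) = f(0) + ∫₀ᵗ Q(f, f)♯`. The degenerate cases `T ≤ 0` / `t = 0` are trivial
(`∫₀⁰ = 0`). [cite: GST2013, §2.1 (2.1.1)] -/
theorem IsClassicalBoltzmannSolutionOn.isMildBoltzmannSolutionOn_holds :
    IsClassicalBoltzmannSolutionOn.isMildBoltzmannSolutionOn := by
  intro d _ T B f hf
  set S : Set ℝ := Icc 0 T with hS_def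
  set F : ℝ × EuclideanSpace ℝ d × EuclideanSpace ℝ d → ℝ := fun z => f z.1 z.2.1 z.2.2 with hF_def
  have hF : ContDiffOn ℝ 1 F (S ×ˢ univ) := hf.contDiffOn
  -- the trivial time `t = 0`
  have h0 : ∀ x v : EuclideanSpace ℝ d, alongFlow (Euclidean.geometry d) f 0 x v =
      f 0 x v + ∫ τ in (0 : ℝ)..0, alongFlow (Euclidean.geometry d) (collisionTerm B f) τ x v := by
    intro x v
    simp
  -- the method of characteristics, for `T > 0`
  have key : ∀ x v : EuclideanSpace ℝ d, 0 < T →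
      ContinuousOn (fun τ => alongFlow (Euclidean.geometry d) f τ x v) S ∧
      ContinuousOn (fun τ => alongFlow (Euclidean.geometry d) (collisionTerm B f) τ x v) S ∧
      ∀ τ ∈ S, HasDerivWithinAt (fun τ => alongFlow (Euclidean.geometry d) f τ x v)
        (alongFlow (Euclidean.geometry d) (collisionTerm B f) τ x v) S τ := by
    intro x v hT
    have hSu : UniqueDiffOn ℝ S := uniqueDiffOn_Icc hT
    have hSU : UniqueDiffOn ℝ (S ×ˢ (univ : Set (EuclideanSpace ℝ d × EuclideanSpace ℝ d))) :=
      hSu.prod uniqueDiffOn_univ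
    have hFdiff : DifferentiableOn ℝ F (S ×ˢ univ) := hF.differentiableOn one_ne_zero
    -- the characteristic curve through `(x, v)`
    set γ : ℝ → ℝ × EuclideanSpace ℝ d × EuclideanSpace ℝ d := fun τ => (τ, x + τ • v, v)
      with hγ_def
    have hγ : ∀ τ, HasDerivAt γ ((1 : ℝ), v, (0 : EuclideanSpace ℝ d)) τ := fun τ => by
      have h2 : HasDerivAt (fun s : ℝ => x + s • v) v τ := by
        simpa using ((hasDerivAt_id' τ).smul_const v).const_add x
      exact (hasDerivAt_id' τ).prodMk (h2.prodMk (hasDerivAt_const τ v))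
    have hγS : MapsTo γ S (S ×ˢ univ) := fun τ hτ => ⟨hτ, mem_univ _⟩
    have hγc : Continuous γ := by
      rw [hγ_def]
      fun_prop
    have hg : (fun τ => alongFlow (Euclidean.geometry d) f τ x v) = F ∘ γ := rfl
    -- chain rule along the characteristic
    have hL : ∀ τ ∈ S, HasDerivWithinAt (F ∘ γ)
        (fderivWithin ℝ F (S ×ˢ univ) (γ τ) ((1 : ℝ), v, (0 : EuclideanSpace ℝ d))) S τ := by
      intro τ hτ
      exact (hFdiff (γ τ) (hγS hτ)).hasFDerivWithinAt.comp_hasDerivWithinAt τ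
        (hγ τ).hasDerivWithinAt hγS
    -- identification of the derivative with `∂ₜ f + v·∇ₓ f = Q(f, f)`
    have hid : ∀ τ ∈ S,
        fderivWithin ℝ F (S ×ˢ univ) (γ τ) ((1 : ℝ), v, (0 : EuclideanSpace ℝ d)) =
          alongFlow (Euclidean.geometry d) (collisionTerm B f) τ x v := by
      intro τ hτ
      set L := fderivWithin ℝ F (S ×ˢ univ) (γ τ) with hL_def
      have hFd : HasFDerivWithinAt F L (S ×ˢ univ) (τ, x + τ • v, v) :=
        (hFdiff (γ τ) (hγS hτ)).hasFDerivWithinAt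
      -- the time direction `(1, 0, 0)`
      have h1 : L ((1 : ℝ), (0 : EuclideanSpace ℝ d × EuclideanSpace ℝ d)) =
          derivWithin (fun s => f s (x + τ • v) v) S τ := by
        have hι : HasDerivAt (fun s : ℝ => (s, x + τ • v, v))
            ((1 : ℝ), (0 : EuclideanSpace ℝ d × EuclideanSpace ℝ d)) τ :=
          (hasDerivAt_id' τ).prodMk (hasDerivAt_const τ (x + τ • v, v))
        have hc := hFd.comp_hasDerivWithinAt τ hι.hasDerivWithinAt
          (fun s hs => mk_mem_prod hs (mem_univ _))
        exact (hc.derivWithin (hSu τ hτ)).symm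
      -- the space direction `(0, v, 0)`
      have h2 : L ((0 : ℝ), v, (0 : EuclideanSpace ℝ d)) =
          fderiv ℝ (fun y => f τ y v) (x + τ • v) v := by
        have hι : HasFDerivAt (fun y : EuclideanSpace ℝ d => (τ, y, v))
            ((0 : EuclideanSpace ℝ d →L[ℝ] ℝ).prod
              ((ContinuousLinearMap.id ℝ (EuclideanSpace ℝ d)).prod
                (0 : EuclideanSpace ℝ d →L[ℝ] EuclideanSpace ℝ d))) (x + τ • v) :=
          (hasFDerivAt_const τ (x + τ • v)).prodMk
            ((hasFDerivAt_id (x + τ • v)).prodMk (hasFDerivAt_const v (x + τ • v)))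
        have hc := hFd.comp (x + τ • v) (hι.hasFDerivWithinAt (s := univ))
          (fun y _ => mk_mem_prod hτ (mem_univ _))
        rw [hasFDerivWithinAt_univ] at hc
        have h3 : fderiv ℝ (fun y => f τ y v) (x + τ • v) =
            L.comp ((0 : EuclideanSpace ℝ d →L[ℝ] ℝ).prod
              ((ContinuousLinearMap.id ℝ (EuclideanSpace ℝ d)).prod
                (0 : EuclideanSpace ℝ d →L[ℝ] EuclideanSpace ℝ d))) := hc.fderiv
        rw [h3]
        simp
      have hsum : ((1 : ℝ), v, (0 : EuclideanSpace ℝ d)) =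
          ((1 : ℝ), (0 : EuclideanSpace ℝ d × EuclideanSpace ℝ d)) +
            ((0 : ℝ), v, (0 : EuclideanSpace ℝ d)) := by
        simp
      rw [hsum, map_add, h1, h2, hf.boltzmann τ hτ (x + τ • v) v]
      rfl
    refine ⟨?_, ?_, ?_⟩
    · rw [hg]
      exact hF.continuousOn.comp hγc.continuousOn hγS
    · refine ContinuousOn.congr
        (f := fun τ => fderivWithin ℝ F (S ×ˢ univ) (γ τ) ((1 : ℝ), v, (0 : EuclideanSpace ℝ d)))
        ?_ (fun τ hτ => (hid τ hτ).symm)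
      exact ((hF.continuousOn_fderivWithin hSU le_rfl).comp hγc.continuousOn hγS).clm_apply
        continuousOn_const
    · intro τ hτ
      rw [hg, ← hid τ hτ]
      exact hL τ hτ
  refine ⟨hf.nonneg, fun x v t ht => ?_, fun x v t ht => ?_⟩
  · rcases ht.1.eq_or_lt with rfl | ht0
    · exact IntervalIntegrable.refl
    obtain ⟨-, hq, -⟩ := key x v (ht0.trans_le ht.2)
    exact (hq.mono (Icc_subset_Icc_right ht.2)).intervalIntegrable_of_Icc ht.1
  · rcases ht.1.eq_or_lt with rfl | ht0
    · exact h0 x v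
    obtain ⟨hgc, hq, hderiv⟩ := key x v (ht0.trans_le ht.2)
    have hsub : Icc 0 t ⊆ S := Icc_subset_Icc_right ht.2
    have hint := (hq.mono hsub).intervalIntegrable_of_Icc (μ := volume) ht.1
    have hFTC := intervalIntegral.integral_eq_sub_of_hasDerivAt_of_le ht.1 (hgc.mono hsub)
      (fun τ hτ => (hderiv τ ⟨hτ.1.le, hτ.2.le.trans ht.2⟩).hasDerivAt
        (Icc_mem_nhds hτ.1 (hτ.2.trans_le ht.2))) hint
    rw [hFTC, alongFlow_zero]
    ring

end ClassicalIsMildProof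

end

end Literature.Analysis.FluidPDE
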